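import Literature.NumberTheory.DiophantineGeometry.PastenSubexpAnalysis
import HarnessLib

/-!
# Pasten's subexponential abc bounds, III: applying the approximation theorem to `±u/v`

Topic `NumberTheory/DiophantineGeometry`; namespace `Literature.NumberTheory.DiophantineGeometry.Pasten`.

Pasten, Invent. Math. 236 (2024), §§4–5 [cite: Pasten2024, §4]: the approximation bound
(Theorem 2.1 with `d = 1`, `Literature.NumberTheory.DiophantineGeometry.Dioph.PastenApproximationBound K`)
is applied to `ξ = ±u/v ∈ Γ = ⟨−1, ξ₀, p (p ∈ I)⟩`, `ξ₀` the cofactor and `I` the big primes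
of `PastenSubexpDecomposition`. With
`Θ = K^{#I+1} · max(1, h(ξ₀)) · ∏_{p ∈ I} log p` (`theta K u v N` of `PastenSubexpDecomposition`) this gives
`−log|1 − ξ| < Θ · log max{e, h(ξ)}` and, for every prime `p`,
`ord_p(1 − ξ) · log p < Θ · (p / log p) · log max{e, p·h(ξ)}` (`approx_div`), together with the
bookkeeping `Θ ≤ K^{#I+1} · max(1, N·log R) · (log R)^{#I}` (`R = rad(uvw)`) and
`(N+1)^{#I} ≤ ∏_{p ∣ uvw} ν_p(uvw)`.

(The sibling file `PastenSubexpGenerators.lean`, landed concurrently by another unit, proves the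
archimedean clause for `ξ = u/v` alone as `neg_log_abs_one_sub_div_le`; the present file is
independent of it and treats both clauses and both signs, which the `p₀`-adic steps of §5 need.)

Design: the generator family handed to `PastenApproximationBound` is indexed by `↥I` when
`ξ₀ = 1` and by `Option ↥I` otherwise (generators must be non-torsion), whence the uniform
exponent `#I + 1 ≥ m` (harmless as `K ≥ 1`). On the name `theta`/`Θ`: the source names no such
quantity — it is the factor `K^m · ∏_{j ∈ I₀} h(ξ_j)` of §4 (`m = #I₀ = #I + 1`), with `h(ξ₀)`
replaced by `max(1, h(ξ₀))` so that the case `ξ₀ = 1` (generator `ξ₀` dropped, `m = #I`) is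
bounded by the same expression. `expDiff_eq_padicValRat` records that the exponent `e_p` of
`PastenSubexpDecomposition` is Mathlib's `padicValRat p (u/v)`, the valuation appearing in clause
(ii) of `PastenApproximationBound` (no new notion is introduced).

## References

* [Pasten2024] H. Pasten, Invent. Math. 236 (2024), 373–385, doi:10.1007/s00222-024-01244-6,
  arXiv:2312.03566 — Theorem 2.1, §4, §5.
-/

noncomputable section

open Finset Real Height
open Literature.NumberTheory.DiophantineGeometry.Dioph

namespace Literature.NumberTheory.DiophantineGeometry.Pasten

/-- Bridge to the `padicValRat` clause of `PastenApproximationBound`: for a prime `p` and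
`u, v ≠ 0`, the exponent `e_p = ν_p(u) − ν_p(v)` is `ord_p(u/v) = padicValRat p (u/v)`.
[folklore] -/
theorem expDiff_eq_padicValRat {u v p : ℕ} (hp : p.Prime) (hu : u ≠ 0) (hv : v ≠ 0) :
    expDiff u v p = padicValRat p ((u : ℚ) / v) := by
  haveI : Fact p.Prime := ⟨hp⟩
  rw [expDiff_def, padicValRat.div (by exact_mod_cast hu) (by exact_mod_cast hv),
    padicValRat.of_nat, padicValRat.of_nat, Nat.factorization_def u hp,
    Nat.factorization_def v hp]

/-- From a generator family as in `PastenApproximationBound` to the bound with any exponent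
`m ≥ #generators` and any `Θ ≥ ∏ h(ξᵢ)` (monotonicity, `K ≥ 1`). [cite: Pasten2024, Theorem 2.1] -/
theorem approx_of_family {K : ℝ} (hK : 1 ≤ K) (hP : PastenApproximationBound K)
    (ι : Type) [Fintype ι] (hι : 0 < Fintype.card ι) (ξs : ι → ℚ)
    (hξs : ∀ i, ξs i ≠ 0 ∧ ξs i ≠ 1 ∧ ξs i ≠ -1) (ζ : ℚ) (hζ : ζ = 1 ∨ ζ = -1) (b : ι → ℤ)
    {ξ : ℚ} (hprod : ζ * ∏ i, ξs i ^ b i = ξ) (hξ1 : ξ ≠ 1)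
    {m : ℕ} (hm : Fintype.card ι ≤ m) {Θ : ℝ} (hΘ : ∏ i, logHeight₁ (ξs i) ≤ Θ) :
    (-Real.log |((1 - ξ : ℚ) : ℝ)| <
        K ^ m * Θ * Real.log (max (Real.exp 1) (logHeight₁ ξ))) ∧
    ∀ p : ℕ, p.Prime → (padicValRat p (1 - ξ) : ℝ) * Real.log p <
        K ^ m * Θ * ((p / Real.log p) * Real.log (max (Real.exp 1) (p * logHeight₁ ξ))) := by
  have hx1 : ζ * ∏ i, ξs i ^ b i ≠ 1 := by rwa [hprod]
  obtain ⟨hA, hN⟩ := hP ι hι ξs hξs ζ hζ b hx1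
  rw [hprod] at hA hN
  have hΘ0 : 0 ≤ ∏ i, logHeight₁ (ξs i) := Finset.prod_nonneg fun i _ => zero_le_logHeight₁ _
  have hK0 : 0 ≤ K := zero_le_one.trans hK
  have hKm : K ^ Fintype.card ι ≤ K ^ m := pow_le_pow_right₀ hK hm
  refine ⟨?_, fun p hp => ?_⟩
  · have h1 := one_le_log_max_exp (logHeight₁ ξ)
    calc -Real.log |((1 - ξ : ℚ) : ℝ)|
        < K ^ Fintype.card ι * Real.log (max (Real.exp 1) (logHeight₁ ξ)) *
            ∏ i, logHeight₁ (ξs i) := hA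
      _ ≤ K ^ m * Real.log (max (Real.exp 1) (logHeight₁ ξ)) * Θ := by
          apply mul_le_mul _ hΘ hΘ0 (mul_nonneg (pow_nonneg hK0 _) (by linarith))
          exact mul_le_mul_of_nonneg_right hKm (by linarith)
      _ = K ^ m * Θ * Real.log (max (Real.exp 1) (logHeight₁ ξ)) := by ring
  · have hp0 : (0 : ℝ) < p := by exact_mod_cast hp.pos
    have hlogp : 0 < Real.log p := Real.log_pos (by exact_mod_cast hp.one_lt)
    have h1 := one_le_log_max_exp (p * logHeight₁ ξ)
    have hpl : 0 ≤ (p : ℝ) / Real.log p := by positivity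
    calc (padicValRat p (1 - ξ) : ℝ) * Real.log p
        < K ^ Fintype.card ι * (p / Real.log p) *
            Real.log (max (Real.exp 1) (p * logHeight₁ ξ)) * ∏ i, logHeight₁ (ξs i) := hN p hp
      _ ≤ K ^ m * (p / Real.log p) * Real.log (max (Real.exp 1) (p * logHeight₁ ξ)) * Θ := by
          apply mul_le_mul _ hΘ hΘ0
            (mul_nonneg (mul_nonneg (pow_nonneg hK0 _) hpl) (by linarith))
          apply mul_le_mul_of_nonneg_right _ (by linarith)
          exact mul_le_mul_of_nonneg_right hKm hpl
      _ = _ := by ring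

/-- **Generic application of the approximation bound.** Let `T` be a finite set of primes,
`e : ℕ → ℤ`, `ξ₀ > 0` with `ξ₀ ≠ 1` if `T = ∅`, `ζ = ±1`, and `ξ = ζ · ξ₀ · ∏_{p ∈ T} p^{e_p} ≠ 1`.
With `Θ := K^{#T+1} · max(1, h(ξ₀)) · ∏_{p ∈ T} log p`:
`−log|1 − ξ| < Θ · log max{e, h(ξ)}` and `ord_p(1 − ξ) log p < Θ · (p/log p) · log max{e, p h(ξ)}`
for every prime `p`. (The group is `Γ = ⟨−1, ξ₀, T⟩`, generated modulo torsion by `T` if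
`ξ₀ = 1` and by `{ξ₀} ∪ T` otherwise.) [cite: Pasten2024, §4] -/
theorem approx_generic {K : ℝ} (hK : 1 ≤ K) (hP : PastenApproximationBound K)
    (T : Finset ℕ) (hT : ∀ p ∈ T, p.Prime) (e : ℕ → ℤ) {ξ₀ : ℚ} (hξ₀ : 0 < ξ₀)
    (hne : T = ∅ → ξ₀ ≠ 1) {ζ : ℚ} (hζ : ζ = 1 ∨ ζ = -1) {ξ : ℚ}
    (hξ : ξ = ζ * (ξ₀ * ∏ p ∈ T, (p : ℚ) ^ e p)) (hξ1 : ξ ≠ 1) :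
    (-Real.log |((1 - ξ : ℚ) : ℝ)| <
        K ^ (T.card + 1) * (max 1 (logHeight₁ ξ₀) * ∏ p ∈ T, Real.log p) *
          Real.log (max (Real.exp 1) (logHeight₁ ξ))) ∧
    ∀ p : ℕ, p.Prime → (padicValRat p (1 - ξ) : ℝ) * Real.log p <
        K ^ (T.card + 1) * (max 1 (logHeight₁ ξ₀) * ∏ p ∈ T, Real.log p) *
          ((p / Real.log p) * Real.log (max (Real.exp 1) (p * logHeight₁ ξ))) := by
  classical
  have hgenT : ∀ p ∈ T, ((p : ℕ) : ℚ) ≠ 0 ∧ ((p : ℕ) : ℚ) ≠ 1 ∧ ((p : ℕ) : ℚ) ≠ -1 := by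
    intro p hp
    have hp' := hT p hp
    refine ⟨by exact_mod_cast hp'.ne_zero, by exact_mod_cast hp'.one_lt.ne', fun h => ?_⟩
    have h0 : (0 : ℚ) ≤ (p : ℚ) := Nat.cast_nonneg p
    rw [h] at h0
    norm_num at h0
  have hhT : ∀ p ∈ T, logHeight₁ ((p : ℕ) : ℚ) = Real.log p := by
    intro p hp
    haveI : NeZero p := ⟨(hT p hp).ne_zero⟩
    exact Rat.logHeight₁_natCast p
  have hlog0 : 0 ≤ ∏ p ∈ T, Real.log p := Finset.prod_nonneg fun p hp =>
    Real.log_nonneg (by exact_mod_cast (hT p hp).one_lt.le)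
  by_cases h1 : ξ₀ = 1
  · -- generators: the primes of `T`
    have hTne : T.Nonempty := by
      rw [Finset.nonempty_iff_ne_empty]
      intro hc
      exact hne hc h1
    have hcard : 0 < Fintype.card T := by
      rw [Fintype.card_coe]; exact hTne.card_pos
    have hprod : ζ * ∏ i : T, (((i : ℕ) : ℚ)) ^ e i = ξ := by
      rw [hξ, h1, one_mul, Finset.prod_coe_sort T fun p => (p : ℚ) ^ e p]
    have hh : ∏ i : T, logHeight₁ (((i : ℕ) : ℚ)) ≤
        max 1 (logHeight₁ ξ₀) * ∏ p ∈ T, Real.log p := by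
      rw [Finset.prod_coe_sort T fun p => logHeight₁ ((p : ℕ) : ℚ), Finset.prod_congr rfl hhT]
      exact le_mul_of_one_le_left hlog0 (le_max_left _ _)
    exact approx_of_family hK hP T hcard (fun i => ((i : ℕ) : ℚ)) (fun i => hgenT i i.2) ζ hζ
      (fun i => e i) hprod hξ1 (by rw [Fintype.card_coe]; exact Nat.le_succ _) hh
  · -- generators: `ξ₀` and the primes of `T`
    have hcard : 0 < Fintype.card (Option T) := Fintype.card_pos
    set ξs : Option T → ℚ := fun o => o.elim ξ₀ fun i => ((i : ℕ) : ℚ) with hξs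
    set b : Option T → ℤ := fun o => o.elim 1 fun i => e i with hb
    have hgen : ∀ o, ξs o ≠ 0 ∧ ξs o ≠ 1 ∧ ξs o ≠ -1 := by
      rintro (_ | i)
      · exact ⟨hξ₀.ne', h1, fun h => by simp only [hξs, Option.elim] at h; linarith⟩
      · exact hgenT i i.2
    have hprod : ζ * ∏ o, ξs o ^ b o = ξ := by
      rw [Fintype.prod_option]
      simp only [hξs, hb, Option.elim, zpow_one]
      rw [hξ, Finset.prod_coe_sort T fun p => (p : ℚ) ^ e p]
    have hh : ∏ o, logHeight₁ (ξs o) ≤ max 1 (logHeight₁ ξ₀) * ∏ p ∈ T, Real.log p := by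
      rw [Fintype.prod_option]
      simp only [hξs, Option.elim]
      rw [Finset.prod_coe_sort T fun p => logHeight₁ ((p : ℕ) : ℚ), Finset.prod_congr rfl hhT]
      exact mul_le_mul_of_nonneg_right (le_max_right _ _) hlog0
    exact approx_of_family hK hP (Option T) hcard ξs hgen ζ hζ b hprod hξ1
      (by rw [Fintype.card_option, Fintype.card_coe]) hh

/-! ### Specialisation to `ξ = ±u/v` -/

/-- `Θ ≥ 1` for `K ≥ 1`… more precisely `Θ ≥ 0`. [folklore] -/
theorem theta_nonneg {K : ℝ} (hK : 0 ≤ K) (u v N : ℕ) : 0 ≤ theta K u v N := by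
  rw [theta_def]
  have := prod_log_bigPrimes_nonneg u v N
  have : (0 : ℝ) ≤ max 1 (logHeight₁ (cofactor u v N)) := zero_le_one.trans (le_max_left _ _)
  positivity

/-- **The approximation bound for `ξ = ±u/v`** (`u, v` coprime positive, `uv > 1`, `ξ ≠ 1`):
`−log|1 − ξ| < Θ · log max{e, h(ξ)}` and `ord_p(1 − ξ) · log p < Θ · (p/log p) · log max{e, p·h(ξ)}`
for every prime `p`, with `Θ = theta K u v N` for ANY threshold `N`. [cite: Pasten2024, §4] -/
theorem approx_div {K : ℝ} (hK : 1 ≤ K) (hP : PastenApproximationBound K) {u v : ℕ}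
    (hu : u ≠ 0) (hv : v ≠ 0) (huv : u.Coprime v) (h1 : 1 < u * v) (N : ℕ) {ζ : ℚ}
    (hζ : ζ = 1 ∨ ζ = -1) (hξ1 : ζ * ((u : ℚ) / v) ≠ 1) :
    (-Real.log |((1 - ζ * ((u : ℚ) / v) : ℚ) : ℝ)| <
        theta K u v N * Real.log (max (Real.exp 1) (logHeight₁ (ζ * ((u : ℚ) / v))))) ∧
    ∀ p : ℕ, p.Prime → (padicValRat p (1 - ζ * ((u : ℚ) / v)) : ℝ) * Real.log p <
        theta K u v N *
          ((p / Real.log p) * Real.log (max (Real.exp 1) (p * logHeight₁ (ζ * ((u : ℚ) / v))))) :=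
  approx_generic hK hP (bigPrimes u v N) (fun _ hp => prime_of_mem_bigPrimes hp) (expDiff u v)
    (cofactor_pos u v N) (fun hT => cofactor_ne_one hu hv huv hT h1) hζ
    (by rw [← cast_div_eq_cofactor_mul_prod hu hv huv N]) hξ1

/-- `h(±u/v) ≤ log u + log v`. [folklore] -/
theorem logHeight₁_sign_mul_div_le {u v : ℕ} (hu : u ≠ 0) (hv : v ≠ 0) {ζ : ℚ}
    (hζ : ζ = 1 ∨ ζ = -1) :
    logHeight₁ (ζ * ((u : ℚ) / v)) ≤ Real.log u + Real.log v := by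
  have h0 : logHeight₁ (ζ * ((u : ℚ) / v)) = logHeight₁ ((u : ℚ) / v) := by
    rcases hζ with rfl | rfl
    · rw [one_mul]
    · rw [neg_one_mul, logHeight₁_neg]
  haveI : NeZero u := ⟨hu⟩
  haveI : NeZero v := ⟨hv⟩
  rw [h0, div_eq_mul_inv]
  calc logHeight₁ ((u : ℚ) * (v : ℚ)⁻¹) ≤ logHeight₁ (u : ℚ) + logHeight₁ ((v : ℚ)⁻¹) :=
        logHeight₁_mul_le _ _
    _ = Real.log u + Real.log v := by
        rw [logHeight₁_inv, Rat.logHeight₁_natCast, Rat.logHeight₁_natCast]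

/-- **Bookkeeping for `Θ`.** With `R = rad(uvw)` (`w` any positive integer) and `L = log R`:
`Θ ≤ K^{#I+1} · max(1, N·L) · L^{#I}`. [cite: Pasten2024, §4] -/
theorem theta_le {K : ℝ} (hK : 1 ≤ K) {u v : ℕ} (hu : u ≠ 0) (hv : v ≠ 0) {w : ℕ} (hw : w ≠ 0)
    (N : ℕ) :
    theta K u v N ≤ K ^ ((bigPrimes u v N).card + 1) *
      (max 1 (N * Real.log (UniqueFactorizationMonoid.radical (u * v * w) : ℕ)) *
        Real.log (UniqueFactorizationMonoid.radical (u * v * w) : ℕ) ^ (bigPrimes u v N).card) := by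
  rw [theta_def]
  have hK0 : 0 ≤ K := zero_le_one.trans hK
  have hprod0 : 0 < ∏ p ∈ (u * v).primeFactors, (p : ℝ) :=
    Finset.prod_pos fun p hp => by exact_mod_cast (Nat.prime_of_mem_primeFactors hp).pos
  have hcof : logHeight₁ (cofactor u v N) ≤
      N * Real.log (UniqueFactorizationMonoid.radical (u * v * w) : ℕ) :=
    (logHeight₁_cofactor_le u v N).trans
      (mul_le_mul_of_nonneg_left
        (Real.log_le_log hprod0 (prod_primeFactors_le_radical hu hv hw)) (Nat.cast_nonneg N))
  apply mul_le_mul_of_nonneg_left _ (pow_nonneg hK0 _)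
  exact mul_le_mul (max_le_max_left 1 hcof) (prod_log_bigPrimes_le hu hv hw N)
    (prod_log_bigPrimes_nonneg u v N) (zero_le_one.trans (le_max_left _ _))

end Literature.NumberTheory.DiophantineGeometry.Pasten

end
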